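import Summits.ValiantsHypothesis.ValiantsHypothesis.Theorems.DepthWindowLowBiasRound
import Summits.ValiantsHypothesis.ValiantsHypothesis.Theorems.DepthWindowNodeBiasPerm

/-!
# Route `DepthWindow` — two-valued words: regrouping, finishing, sorting

Cone-free helper (decomp-valiant lens 4, g15) supporting the crux item `HomImmHardTwoOne`
(stmt-ValiantsHypothesis-30635).  Word-level tools for the universal low-bias-tree builder on two-letter words
(`DepthWindowTwoLetterULB`), all stated for the CANONICAL two-valued word `twoWord A B x y` (first `A` letters
`x`, then `B` letters `y`):

* `lowBiasTree_regroup` — ONE ROUND: if `A = A₁g₁' + B₁g₂'`, `B = A₁g₁ + B₁g₂`, both block compositions are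
  non-empty and have `ℓ¹`-mass `g'|x| + g|y| ≤ β`, then a depth-`Δ` low-bias tree of the regrouped word
  `twoWord A₁ B₁ (g₁'x + g₁y) (g₂'x + g₂y)` lifts to a depth-`(Δ+1)` one of `twoWord A B x y` (an explicit onto
  grouping map + `lowBiasTree_succ_of_quotient`);
* `lowBiasTree_twoWord_of_sameSign` — FINISH: if `x, y` have the same weak sign and `|Ax + By| ≤ β`, every depth
  `≥ 1` works (star + padding);
* `lowBiasTree_of_twoValued` — SORTING: a two-valued word `w : Fin d → ℤ` (values `x ≠ y`) inherits low-bias trees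
  from `twoWord #{w = x} #{w ≠ x} x y` (reindexing invariance, `DepthWindowNodeBiasPerm`);
* `LowBiasTree.neg` — negation invariance.

References: [LimayeSrinivasanTavenas2022] full version Def. 15, Prop. 16.
-/

-- layout Summits/ValiantsHypothesis/ValiantsHypothesis forces the duplicated namespace component
set_option linter.dupNamespace false

namespace Summit.ValiantsHypothesis.ValiantsHypothesis.Theorems.DepthWindow.TreeBias

open Finset

/-! ### Canonical two-valued words -/

/-- The canonical two-valued word: `A` letters `x` followed by `B` letters `y`. [folklore] -/
def twoWord (A B : ℕ) (x y : ℤ) : Fin (A + B) → ℤ := fun i => if (i : ℕ) < A then x else y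

/-- Its total is `A·x + B·y`. [folklore] -/
theorem sum_twoWord (A B : ℕ) (x y : ℤ) : ∑ i, twoWord A B x y i = A * x + B * y := by
  unfold twoWord
  rw [Fin.sum_univ_eq_sum_range (fun i => if i < A then x else y) (A + B), sum_range_add]
  rw [sum_congr rfl fun i hi => if_pos (mem_range.1 hi),
    sum_congr rfl fun i _ => if_neg (by omega : ¬ A + i < A)]
  simp

/-- Absolute values of a two-valued word form the two-valued word of the absolute values. [folklore] -/
theorem abs_twoWord (A B : ℕ) (x y : ℤ) (i : Fin (A + B)) : |twoWord A B x y i| = twoWord A B |x| |y| i := by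
  unfold twoWord; split_ifs <;> rfl

/-! ### Counting positions in a block layout -/

/-- Block index of position `i` in a segment laid out as `n₁` blocks of size `G₁` followed by blocks of size
`G₂`. [folklore] -/
def blk (n₁ G₁ G₂ i : ℕ) : ℕ := if i < n₁ * G₁ then i / G₁ else n₁ + (i - n₁ * G₁) / G₂

/-- `a / k = b ↔ b·k ≤ a < (b+1)·k` for `k > 0`. [folklore] -/
private theorem nat_div_eq_iff {a b k : ℕ} (hk : 0 < k) : a / k = b ↔ b * k ≤ a ∧ a < (b + 1) * k := by
  rw [← Nat.le_div_iff_mul_le hk, ← Nat.div_lt_iff_lt_mul hk]; omega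

/-- Positions of a segment of `n₁G₁ + n₂G₂` letters land in blocks `< n₁ + n₂`. [folklore] -/
theorem blk_lt {n₁ n₂ G₁ G₂ i : ℕ} (hi : i < n₁ * G₁ + n₂ * G₂) : blk n₁ G₁ G₂ i < n₁ + n₂ := by
  unfold blk
  split_ifs with h
  · have := Nat.div_lt_of_lt_mul (show i < G₁ * n₁ by rwa [Nat.mul_comm n₁ G₁] at h)
    omega
  · have h2 : i - n₁ * G₁ < G₂ * n₂ := by rw [Nat.mul_comm G₂ n₂]; omega
    have := Nat.div_lt_of_lt_mul h2
    omega

/-- A left block (`m < n₁`) holds exactly `G₁` positions. [folklore] -/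
theorem filter_blk_eq_left (n₁ n₂ G₁ G₂ : ℕ) {m : ℕ} (hm : m < n₁) :
    (range (n₁ * G₁ + n₂ * G₂)).filter (fun i => blk n₁ G₁ G₂ i = m) = Ico (m * G₁) (m * G₁ + G₁) := by
  ext i
  simp only [mem_filter, mem_range, mem_Ico, blk]
  constructor
  · rintro ⟨hi, hb⟩
    by_cases h : i < n₁ * G₁
    · rw [if_pos h] at hb
      have hG : 0 < G₁ := Nat.pos_of_ne_zero (by rintro rfl; simp at h)
      rw [nat_div_eq_iff hG, Nat.add_mul, one_mul] at hb
      omega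
    · rw [if_neg h] at hb
      have := Nat.le_add_right n₁ ((i - n₁ * G₁) / G₂)
      omega
  · rintro ⟨h1, h2⟩
    rcases Nat.eq_zero_or_pos G₁ with rfl | hG
    · simp at h2
    have hmG : m * G₁ + G₁ ≤ n₁ * G₁ := by
      have := Nat.mul_le_mul_right G₁ hm; rwa [Nat.succ_mul] at this
    refine ⟨by omega, ?_⟩
    rw [if_pos (by omega : i < n₁ * G₁), nat_div_eq_iff hG, Nat.add_mul, one_mul]
    omega

/-- A right block (`n₁ + m`, `m < n₂`) holds exactly `G₂` positions. [folklore] -/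
theorem filter_blk_eq_right (n₁ n₂ G₁ G₂ : ℕ) {m : ℕ} (hm : m < n₂) :
    (range (n₁ * G₁ + n₂ * G₂)).filter (fun i => blk n₁ G₁ G₂ i = n₁ + m) =
      Ico (n₁ * G₁ + m * G₂) (n₁ * G₁ + m * G₂ + G₂) := by
  ext i
  simp only [mem_filter, mem_range, mem_Ico, blk]
  constructor
  · rintro ⟨hi, hb⟩
    by_cases h : i < n₁ * G₁
    · rw [if_pos h] at hb
      have := Nat.div_lt_of_lt_mul (show i < G₁ * n₁ by rwa [Nat.mul_comm n₁ G₁] at h)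
      omega
    · rw [if_neg h] at hb
      have hb' : (i - n₁ * G₁) / G₂ = m := by omega
      rcases Nat.eq_zero_or_pos G₂ with rfl | hG
      · simp at hi; omega
      · rw [nat_div_eq_iff hG, Nat.add_mul, one_mul] at hb'
        omega
  · rintro ⟨h1, h2⟩
    rcases Nat.eq_zero_or_pos G₂ with rfl | hG
    · simp at h2 h1; omega
    have hmG : m * G₂ + G₂ ≤ n₂ * G₂ := by
      have := Nat.mul_le_mul_right G₂ hm; rwa [Nat.succ_mul] at this
    refine ⟨by omega, ?_⟩
    rw [if_neg (by omega)]
    suffices (i - n₁ * G₁) / G₂ = m by rw [this]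
    rw [nat_div_eq_iff hG, Nat.add_mul, one_mul]
    omega

/-- Number of positions of a segment in block `m`: `G₁` for the left blocks, `G₂` for the right ones. [folklore] -/
theorem card_filter_blk (n₁ n₂ G₁ G₂ : ℕ) {m : ℕ} (hm : m < n₁ + n₂) :
    ((range (n₁ * G₁ + n₂ * G₂)).filter (fun i => blk n₁ G₁ G₂ i = m)).card = if m < n₁ then G₁ else G₂ := by
  split_ifs with h
  · rw [filter_blk_eq_left n₁ n₂ G₁ G₂ h, Nat.card_Ico]; omega
  · obtain ⟨m', rfl⟩ : ∃ m', m = n₁ + m' := ⟨m - n₁, by omega⟩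
    rw [filter_blk_eq_right n₁ n₂ G₁ G₂ (by omega : m' < n₂), Nat.card_Ico]; omega

/-! ### The regrouping map and its fibres -/

section regroup

variable {A B A₁ B₁ g₁' g₁ g₂' g₂ : ℕ} (hA : A = A₁ * g₁' + B₁ * g₂') (hB : B = A₁ * g₁ + B₁ * g₂)

/-- The block of position `i < A + B`: `x`-letters are distributed `g₁'` per left block and `g₂'` per right block,
`y`-letters `g₁` per left block and `g₂` per right block. [folklore] -/
def regroupNat (A A₁ g₁' g₁ g₂' g₂ i : ℕ) : ℕ := if i < A then blk A₁ g₁' g₂' i else blk A₁ g₁ g₂ (i - A)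

include hA hB in
/-- The regrouping lands in `Fin (A₁ + B₁)`. [folklore] -/
theorem regroupNat_lt (i : Fin (A + B)) : regroupNat A A₁ g₁' g₁ g₂' g₂ i < A₁ + B₁ := by
  unfold regroupNat
  split_ifs with h
  · exact blk_lt (by rw [← hA]; exact h)
  · exact blk_lt (by rw [← hB]; have := i.isLt; omega)

/-- The **regrouping map** `Fin (A + B) → Fin (A₁ + B₁)`. [folklore] -/
def regroup (i : Fin (A + B)) : Fin (A₁ + B₁) := ⟨regroupNat A A₁ g₁' g₁ g₂' g₂ i, regroupNat_lt hA hB i⟩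

/-- **Fibre sums.**  Over the fibre of block `m`, a two-valued word `(X on x-letters, Y on y-letters)` sums to
`g'·X + g·Y` with `(g', g)` the composition of the block. [folklore] -/
theorem sum_fiber_regroup (X Y : ℤ) (m : Fin (A₁ + B₁)) :
    ∑ i ∈ univ.filter (fun i => regroup hA hB i = m), twoWord A B X Y i =
      (if (m : ℕ) < A₁ then (g₁' : ℤ) * X + (g₁ : ℤ) * Y else (g₂' : ℤ) * X + (g₂ : ℤ) * Y) := by
  rw [sum_filter]
  have hval : ∀ i : Fin (A + B), (regroup hA hB i = m) = (regroupNat A A₁ g₁' g₁ g₂' g₂ i = m) := fun i =>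
    propext ⟨fun h => by rw [← h]; rfl, fun h => Fin.ext h⟩
  simp only [hval]
  unfold twoWord
  rw [Fin.sum_univ_eq_sum_range (fun i => if regroupNat A A₁ g₁' g₁ g₂' g₂ i = m then
      (if i < A then X else Y) else 0) (A + B), sum_range_add]
  have h1 : ∑ i ∈ range A, (if regroupNat A A₁ g₁' g₁ g₂' g₂ i = m then (if i < A then X else Y) else 0) =
      ∑ i ∈ range A, (if blk A₁ g₁' g₂' i = m then X else 0) := by
    refine sum_congr rfl fun i hi => ?_
    rw [mem_range] at hi
    simp [regroupNat, hi]
  have h2 : ∑ i ∈ range B, (if regroupNat A A₁ g₁' g₁ g₂' g₂ (A + i) = m then (if A + i < A then X else Y)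
      else 0) = ∑ i ∈ range B, (if blk A₁ g₁ g₂ i = m then Y else 0) := by
    refine sum_congr rfl fun i _ => ?_
    simp [regroupNat]
  rw [h1, h2, ← sum_filter, ← sum_filter, sum_const, sum_const, hA, card_filter_blk A₁ B₁ g₁' g₂' m.isLt,
    hB, card_filter_blk A₁ B₁ g₁ g₂ m.isLt]
  split_ifs <;> simp

include hA hB in
/-- The regrouping is onto as soon as both compositions are non-empty. [folklore] -/
theorem regroup_surjective (h₁ : 1 ≤ g₁' + g₁) (h₂ : 1 ≤ g₂' + g₂) : Function.Surjective (regroup hA hB) := by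
  intro m
  have hs := sum_fiber_regroup hA hB 1 1 m
  by_contra hne
  push Not at hne
  rw [filter_false_of_mem (fun i _ => hne i), sum_empty] at hs
  split_ifs at hs <;> omega

/-- The quotient word of the regrouping is the regrouped two-valued word. [folklore] -/
theorem quotWord_regroup (X Y : ℤ) :
    quotWord (twoWord A B X Y) (regroup hA hB) =
      twoWord A₁ B₁ ((g₁' : ℤ) * X + (g₁ : ℤ) * Y) ((g₂' : ℤ) * X + (g₂ : ℤ) * Y) := by
  funext m
  unfold quotWord
  rw [sum_fiber_regroup]
  rfl

include hA hB in
/-- **One round on a two-valued word (regrouping).**  [cite: LimayeSrinivasanTavenas2022, Def. 15, Prop. 16] -/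
theorem lowBiasTree_regroup (h₁ : 1 ≤ g₁' + g₁) (h₂ : 1 ≤ g₂' + g₂) {X Y β : ℤ}
    (hm₁ : (g₁' : ℤ) * |X| + (g₁ : ℤ) * |Y| ≤ β) (hm₂ : (g₂' : ℤ) * |X| + (g₂ : ℤ) * |Y| ≤ β) {Δ : ℕ}
    (hT : LowBiasTree (twoWord A₁ B₁ ((g₁' : ℤ) * X + (g₁ : ℤ) * Y) ((g₂' : ℤ) * X + (g₂ : ℤ) * Y)) Δ β) :
    LowBiasTree (twoWord A B X Y) (Δ + 1) β := by
  refine lowBiasTree_succ_of_quotient (regroup hA hB) (regroup_surjective hA hB h₁ h₂) (fun m => ?_)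
    (by rwa [quotWord_regroup])
  rw [sum_congr rfl fun i _ => abs_twoWord A B X Y i, sum_fiber_regroup]
  split_ifs
  · exact hm₁
  · exact hm₂

end regroup

/-! ### Finishing: same-sign words -/

/-- A word all of whose letters are `≥ 0`, or all `≤ 0`, has `Σ |wᵢ| = |Σ wᵢ|`. [folklore] -/
theorem sum_abs_eq_abs_sum_of_sameSign {d : ℕ} (w : Fin d → ℤ) (hw : (∀ i, 0 ≤ w i) ∨ (∀ i, w i ≤ 0)) :
    ∑ i, |w i| = |∑ i, w i| := by
  rcases hw with hw | hw
  · rw [abs_of_nonneg (sum_nonneg fun i _ => hw i)]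
    exact sum_congr rfl fun i _ => abs_of_nonneg (hw i)
  · rw [abs_of_nonpos (sum_nonpos fun i _ => hw i), ← sum_neg_distrib]
    exact sum_congr rfl fun i _ => abs_of_nonpos (hw i)

/-- **Finish.**  If `x, y` have the same weak sign and `|A·x + B·y| ≤ β`, the two-valued word has low-bias trees of
every depth `≥ 1`. [folklore] -/
theorem lowBiasTree_twoWord_of_sameSign {A B : ℕ} {x y β : ℤ} (hs : (0 ≤ x ∧ 0 ≤ y) ∨ (x ≤ 0 ∧ y ≤ 0))
    (hb : |(A : ℤ) * x + (B : ℤ) * y| ≤ β) {Δ : ℕ} (hΔ : 1 ≤ Δ) : LowBiasTree (twoWord A B x y) Δ β := by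
  apply lowBiasTree_of_sum_abs_le _ hΔ
  rw [sum_abs_eq_abs_sum_of_sameSign, sum_twoWord]
  · exact hb
  · rcases hs with ⟨hx, hy⟩ | ⟨hx, hy⟩
    · exact Or.inl fun i => by unfold twoWord; split_ifs <;> assumption
    · exact Or.inr fun i => by unfold twoWord; split_ifs <;> assumption

/-! ### Negation and sorting -/

/-- Negation invariance of low-bias trees. [folklore] -/
theorem LowBiasTree.neg {d : ℕ} {w : Fin d → ℤ} {Δ : ℕ} {β : ℤ} (hT : LowBiasTree w Δ β) :
    LowBiasTree (fun i => -w i) Δ β := by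
  obtain ⟨T, hroot, hnb⟩ := hT
  refine ⟨T, hroot, fun u hu1 hu i => ?_⟩
  have : nodeBias (fun i => -w i) T u i = nodeBias w T u i := by
    unfold nodeBias blockSum
    exact sum_congr rfl fun l _ => by rw [sum_neg_distrib, abs_neg]
  rw [this]; exact hnb u hu1 hu i

/-- Transport along `Fin n ≃ Fin d` given by `n = d`. [folklore] -/
theorem lowBiasTree_of_comp_finCongr {n d : ℕ} (h : n = d) {w : Fin d → ℤ} {Δ : ℕ} {β : ℤ}
    (hT : LowBiasTree (w ∘ finCongr h) Δ β) : LowBiasTree w Δ β := by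
  subst h; simpa using hT

/-- **Sorting.**  A two-valued word `w` (values `x ≠ y`) is a reindexing of `twoWord #{w = x} #{w ≠ x} x y`, so it
inherits its low-bias trees (`x = y` is allowed). [folklore] -/
theorem lowBiasTree_of_twoValued {d : ℕ} (w : Fin d → ℤ) {x y : ℤ} (hw : ∀ i, w i = x ∨ w i = y)
    {Δ : ℕ} {β : ℤ}
    (hT : LowBiasTree (twoWord (univ.filter fun i => w i = x).card (univ.filter fun i => ¬ w i = x).card x y) Δ β) :
    LowBiasTree w Δ β := by
  set A := (univ.filter fun i => w i = x).card with hAdef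
  set B := (univ.filter fun i => ¬ w i = x).card with hBdef
  have hAB : A + B = d := by
    rw [hAdef, hBdef, card_filter_add_card_filter_not, card_univ, Fintype.card_fin]
  -- the sorting equivalence Fin (A + B) ≃ Fin d
  have hcA : Fintype.card {i // w i = x} = A := by rw [Fintype.card_subtype]
  have hcB : Fintype.card {i // ¬ w i = x} = B := by rw [Fintype.card_subtype]
  let eA : Fin A ≃ {i // w i = x} := (Fintype.equivFinOfCardEq hcA).symm
  let eB : Fin B ≃ {i // ¬ w i = x} := (Fintype.equivFinOfCardEq hcB).symm
  let e : Fin (A + B) ≃ Fin d :=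
    finSumFinEquiv.symm.trans ((eA.sumCongr eB).trans (Equiv.sumCompl fun i => w i = x))
  have hwe : w ∘ e = twoWord A B x y := by
    funext k
    simp only [Function.comp_apply, twoWord]
    by_cases hk : (k : ℕ) < A
    · rw [if_pos hk]
      have hk' : k = Fin.castAdd B ⟨k, hk⟩ := Fin.ext rfl
      rw [hk']
      simp only [e, Equiv.trans_apply, finSumFinEquiv_symm_apply_castAdd, Equiv.sumCongr_apply, Sum.map_inl,
        Equiv.sumCompl_apply_inl]
      exact (eA ⟨k, hk⟩).2
    · rw [if_neg hk]
      have hk' : k = Fin.natAdd A ⟨k - A, by omega⟩ := Fin.ext (by simp; omega)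
      rw [hk']
      simp only [e, Equiv.trans_apply, finSumFinEquiv_symm_apply_natAdd, Equiv.sumCongr_apply, Sum.map_inr,
        Equiv.sumCompl_apply_inr]
      exact (hw _).resolve_left (eB ⟨k - A, by omega⟩).2
  -- transport: w ∘ e = (w ∘ e') ∘ finCongr hAB with e' : Fin d ≃ Fin d
  let e' : Fin d ≃ Fin d := (finCongr hAB).symm.trans e
  have hfac : (w ∘ e') ∘ finCongr hAB = w ∘ e := by
    funext k; simp [e']
  refine lowBiasTree_of_comp_equiv e' (lowBiasTree_of_comp_finCongr hAB ?_)
  rw [hfac, hwe]; exact hT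

end Summit.ValiantsHypothesis.ValiantsHypothesis.Theorems.DepthWindow.TreeBias
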